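import Literature.MathematicalPhysics.QuantumLattice.HubbardFreePropagatorLimit
import Literature.MathematicalPhysics.QuantumLattice.HubbardFermiLiquid
import Literature.Probability.LatticeModels.DiscretePoissonSummation
import Literature.Analysis.FluidPDE.ScalarFourierData
import Literature.Analysis.FunctionSpaces.FlatTorus
import HarnessLib

/-!
# The free Hubbard propagator on the torus is the periodization of the infinite-volume one;
decay of the infinite-volume propagator and the finite-size correction

Topic `MathematicalPhysics/QuantumLattice`; programme under the tree's fact `bgm_two_point_limit`
(`HubbardFermiLiquid.lean`: Benfatto–Giuliani–Mastropietro 2006, Thm. 1.1, convergence of the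
finite-volume thermal two-point functions `hubbardThermalTwoPoint β U μ L x y σ σ'` as `L → ∞`).
Continuation of `HubbardFreePropagator.lean` (the `U = 0` two-point function as the momentum sum
`L⁻² Σ_{k ∈ (ℤ/Lℤ)²} e^{i p_k·(y-x)} f_β(ε(p_k) - μ)`, `p_k = 2πk/L`, BGM (1.4)) and
`HubbardFreePropagatorLimit.lean` (its `L → ∞` limit as a Brillouin-zone integral, by Riemann
sums), using the discrete Poisson summation formula of
`Literature.Probability.LatticeModels.DiscretePoissonSummation` and the decay of the Fourier
coefficients of smooth functions on `𝕋^d` (`Literature.Analysis.FluidPDE.ScalarFourier`).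

BGM treat the finite volume `L` formally (§2.2, footnote 1 on p. 8 of the arXiv text: "the
rigorous way to proceed should be performing bounds at finite `L`, showing uniformity in `L` and
then performing the limit … our bounds can be adapted also to the finite `L` case, and the
resulting estimates turn out to be uniform in `L` for `L` big enough"). The mechanism behind that
uniformity for the free propagator is made explicit and PROVED here, in every dimension `d`:

* `hubbardFreeSymbol β μ : 𝕋^d → ℂ`, `t ↦ f_β(-2 Σᵢ cos 2πtᵢ - μ)` — the Fermi occupation of the band in
  the tree's convention (hopping `1`), as a SMOOTH function on Mathlib's `UnitAddTorus (Fin d)`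
  (`isSmooth_hubbardFreeSymbol`; `cos 2πtᵢ = Re e^{2πi tᵢ}` keeps it a genuine function on the torus);
* `freePropagatorInfinite β μ z = ∫_{𝕋^d} e^{2πi t·z} f_β(-2Σcos 2πtᵢ - μ) dt` — the infinite-volume
  equal-time free propagator `(2π)^{-d} ∫_{[0,2π]^d} e^{ip·z} f_β(ε(p) - μ) dp` (BGM (2.4) at equal
  times, "in the limit `L → ∞`"), as the multiple Fourier coefficient `𝓕(hubbardFreeSymbol)(-z)`;
* **decay**: `Σ_{z ∈ ℤ^d} |freePropagatorInfinite β μ z| < ∞` and, for every `K`,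
  `|freePropagatorInfinite β μ z| ≤ C_K (1 + |z|)^{-K}` (`summable_norm_freePropagatorInfinite`,
  `exists_decay_freePropagatorInfinite`; smoothness of the symbol — at `β < ∞` the Fermi surface
  singularity is smeared, BGM §2.2: the temperature acts as an infrared cutoff);
* **sum over images** (`hubbardThermalTwoPoint_zero_interaction_eq_tsum_images`): for `L ≥ 3`,
  `⟨c†_{xσ} c_{yσ'}⟩_{β,L,U=0} = δ_{σσ'} Σ_{n ∈ ℤ²} freePropagatorInfinite β μ (y - x + Ln)` — the
  torus propagator is the periodization of the infinite-volume one (Glimm–Jaffe 1987 Prop. 7.3.1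
  on the lattice: the Fourier series of the smooth symbol converges absolutely, so its samples at
  the torus momenta are the `ℤ^d`-Fourier transform of the coefficients and
  `torusFourierInv_latticeFourierTorus_eq_tsum_translate` applies);
* **finite-size correction** (`norm_hubbardThermalTwoPoint_zero_interaction_sub_le`): for
  `R + 1 + Σᵢ|(y-x)ᵢ| ≤ L`,
  `|⟨c†_{xσ} c_{yσ}⟩_{β,L,U=0} - freePropagatorInfinite β μ (y-x)| ≤ Σ_{w ∉ {-R..R}²} |freePropagatorInfinite β μ w|`
  — a tail of a convergent series, whence the thermodynamic limit once more
  (`tendsto_hubbardThermalTwoPoint_zero_interaction'`) and, by uniqueness of limits, the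
  identification of `freePropagatorInfinite` with the Brillouin-zone integral of
  `HubbardFreePropagatorLimit.lean` (`freePropagatorInfinite_eq_integral_brillouin`).

Everything is PROVED; the definitions are `torusPoint` (the point `k/L ∈ 𝕋^d` of a torus
momentum), `hubbardFreeSymbol` and `freePropagatorInfinite`.

## Mathlib / tree search

Mathlib: `UnitAddTorus.mFourier`, `mFourierCoeff`, `hasSum_mFourier_series_apply_of_summable`
(pointwise Fourier inversion for summable coefficients), `fourier_coe_apply`. Tree:
`DiscretePoissonSummation` (`latticeFourierTorus`, `torusFourierInv_latticeFourierTorus_eq_tsum_translate`,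
`norm_tsum_translate_sub_le`, `tendsto_tsum_translate`), `FlatTorus` (`Torus.IsSmooth`, `lift`),
`ScalarFourierData` (`ScalarFourier.summable_norm_mFourierCoeff`, `exists_hasDecay_mFourierCoeff`),
`HubbardFreePropagator` (`thermalCorr_hubbardTorusWith_zero_interaction_eq_sum_latticeMomentum`,
`torusChar_proj`), `HubbardFreePropagatorLimit` (`tendsto_hubbardThermalTwoPoint_zero_interaction`).

## References

* G. Benfatto, A. Giuliani, V. Mastropietro, Ann. Henri Poincaré 7 (2006) 809–898, §1 (1.4),
  §2.1 (2.4), §2.2 footnote 1 (arXiv:cond-mat/0507686 pp. 2, 5, 8).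
  [BenfattoGiulianiMastropietro2006]
* J. Glimm, A. Jaffe, *Quantum Physics. A Functional Integral Point of View*, 2nd ed. (1987),
  §7.3, Prop. 7.3.1 (periodic covariance = sum over images). [GlimmJaffeQP1987]
* L. Grafakos, *Classical Fourier Analysis*, 3rd ed. (2014), §3.3.1 (decay of the Fourier
  coefficients of smooth functions on `𝕋^d`). [Grafakos2014]
-/

noncomputable section

open Filter Complex Finset UnitAddTorus
open scoped Topology ComplexConjugate
open Literature.Probability.LatticeModels
open Literature.Analysis.FunctionSpaces.Torus (IsSmooth)

namespace Literature.MathematicalPhysics.QuantumLattice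

variable {d : ℕ}

/-! ### Torus momenta as points of `𝕋^d = (ℝ/ℤ)^d`; sampling an absolutely convergent Fourier series -/

section Sampling

variable {L : ℕ}

/-- The point `t_k = k/L ∈ 𝕋^d = (ℝ/ℤ)^d` attached to a torus momentum index `k ∈ (ℤ/Lℤ)^d`
(so that `2π t_k = p_k = 2πk/L` is the lattice momentum `latticeMomentum L k`). [folklore] -/
def torusPoint (L : ℕ) (k : TorusSite d L) : UnitAddTorus (Fin d) :=
  fun i => ((((k i).val : ℝ) / L : ℝ) : UnitAddCircle)

/-- The Fourier monomials at `t_k` are the characters of `(ℤ/Lℤ)^d`: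
`e^{2πi n·k/L} = χ_k(n̄)`. [folklore] -/
theorem mFourier_torusPoint [NeZero L] (n : Site d) (k : TorusSite d L) :
    mFourier n (torusPoint L k) = torusChar k (Torus.proj L n) := by
  rw [torusChar_proj, Finset.mul_sum, Complex.exp_sum]
  simp only [mFourier, ContinuousMap.coe_mk, torusPoint]
  refine Finset.prod_congr rfl fun i _ => ?_
  rw [fourier_coe_apply]
  congr 1
  simp only [latticeMomentum]
  push_cast
  ring

/-- `Torus.proj` commutes with negation. [folklore] -/
private theorem proj_neg' (L : ℕ) (n : Site d) : Torus.proj L (-n) = -Torus.proj L n := by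
  funext i
  simp [Torus.proj]

/-- **Sampling an absolutely convergent Fourier series at the torus momenta**: if
`g : 𝕋^d → ℂ` is continuous with absolutely summable Fourier coefficients then
`g(k/L) = Σ_{x ∈ ℤ^d} e^{-2πi x·k/L} 𝓕g(-x)`, i.e. the samples of `g` at the torus momenta are the
`ℤ^d`-Fourier transform (`latticeFourierTorus`) of the kernel `x ↦ 𝓕g(-x)` (pointwise Fourier
inversion, Mathlib `hasSum_mFourier_series_apply_of_summable`). [folklore] -/
theorem apply_torusPoint_eq_latticeFourierTorus [NeZero L] (g : C(UnitAddTorus (Fin d), ℂ))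
    (hg : Summable fun n => ‖mFourierCoeff g n‖) (k : TorusSite d L) :
    g (torusPoint L k) = latticeFourierTorus L (fun x => mFourierCoeff g (-x)) k := by
  have h := hasSum_mFourier_series_apply_of_summable (Summable.of_norm hg) (torusPoint L k)
  rw [latticeFourierTorus_apply, ← h.tsum_eq,
    ← (Equiv.neg (Site d)).tsum_eq (fun x => conj (torusChar k (Torus.proj L x)) * mFourierCoeff g (-x))]
  refine tsum_congr fun n => ?_
  rw [Equiv.neg_apply, neg_neg, proj_neg', torusChar_neg_right, RingHomCompTriple.comp_apply,
    RingHom.id_apply, smul_eq_mul, mFourier_torusPoint, mul_comm]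

/-- **Sum over images for a continuous symbol with summable coefficients**: for such `g` and
`z ∈ ℤ^d`, `L^{-d} Σ_{k ∈ (ℤ/Lℤ)^d} χ_k(z̄) g(k/L) = Σ_{n ∈ ℤ^d} 𝓕g(-(z + Ln))`
(Glimm–Jaffe 1987, Prop. 7.3.1 on the lattice, via
`torusFourierInv_latticeFourierTorus_eq_tsum_translate`). [cite: GlimmJaffeQP1987, Prop. 7.3.1] -/
theorem torusFourierInv_apply_torusPoint_eq_tsum [NeZero L] (g : C(UnitAddTorus (Fin d), ℂ))
    (hg : Summable fun n => ‖mFourierCoeff g n‖) (z : Site d) :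
    torusFourierInv (fun k => g (torusPoint L k)) (Torus.proj L z) =
      ∑' n : Site d, mFourierCoeff g (-(z + (L : ℤ) • n)) := by
  have ha : Summable fun x : Site d => ‖mFourierCoeff g (-x)‖ :=
    (hg.comp_injective neg_injective :)
  have hfun : (fun k => g (torusPoint L k)) = latticeFourierTorus L (fun x => mFourierCoeff g (-x)) :=
    funext fun k => apply_torusPoint_eq_latticeFourierTorus g hg k
  rw [hfun, torusFourierInv_latticeFourierTorus_eq_tsum_translate ha z]

end Sampling

/-! ### The free symbol `f_β(ε(p) - μ)` as a smooth function on `𝕋^d` -/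

section Symbol

variable (β μ : ℝ)

/-- **The free propagator symbol on the torus** (BGM 2006, (1.4) after the Matsubara sum; tree
convention hopping `1`): `t ↦ f_β(-2 Σᵢ cos 2πtᵢ - μ) = (1 + e^{β(-2Σcos 2πtᵢ - μ)})⁻¹`, a function
on `𝕋^d = (ℝ/ℤ)^d` (`cos 2πtᵢ = Re e^{2πi tᵢ}`, Mathlib `fourier 1`).
[cite: BenfattoGiulianiMastropietro2006, eq. (1.4)] -/
def hubbardFreeSymbol (t : UnitAddTorus (Fin d)) : ℂ :=
  ((fermiFunction β (-2 * ∑ i, (fourier 1 (t i)).re - μ) : ℝ) : ℂ)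

/-- `Re e^{2πi x} = cos 2πx`. [folklore] -/
theorem fourier_one_coe_re (x : ℝ) : (fourier 1 (x : UnitAddCircle)).re = Real.cos (2 * Real.pi * x) := by
  rw [fourier_coe_apply]
  have : (2 * (Real.pi : ℂ) * I * ((1 : ℤ) : ℂ) * (x : ℂ) / ((1 : ℝ) : ℂ)) =
      ((2 * Real.pi * x : ℝ) : ℂ) * I := by
    push_cast
    ring
  rw [this, Complex.exp_ofReal_mul_I_re]

/-- The symbol on real coordinates: `hubbardFreeSymbol β μ (y mod ℤ^d) = f_β(-2 Σᵢ cos 2πyᵢ - μ)`. [folklore] -/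
theorem hubbardFreeSymbol_coe (y : Fin d → ℝ) :
    hubbardFreeSymbol β μ (fun i => ((y i : ℝ) : UnitAddCircle)) =
      ((fermiFunction β (-2 * ∑ i, Real.cos (2 * Real.pi * y i) - μ) : ℝ) : ℂ) := by
  simp only [hubbardFreeSymbol, fourier_one_coe_re]

/-- At the torus momenta the symbol is BGM's integrand: `hubbardFreeSymbol β μ (k/L) = f_β(ε(p_k) - μ)`
with `p_k = 2πk/L` and `ε(p) = -2 Σᵢ cos pᵢ`. [cite: BenfattoGiulianiMastropietro2006, eq. (1.4)] -/
theorem hubbardFreeSymbol_torusPoint {L : ℕ} (k : TorusSite d L) :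
    hubbardFreeSymbol β μ (torusPoint L k) =
      ((fermiFunction β (-2 * ∑ i, Real.cos (latticeMomentum L k i) - μ) : ℝ) : ℂ) := by
  rw [show torusPoint L k = fun i => ((((k i).val : ℝ) / L : ℝ) : UnitAddCircle) from rfl,
    hubbardFreeSymbol_coe]
  congr 4
  refine Finset.sum_congr rfl fun i _ => ?_
  simp only [latticeMomentum]
  ring_nf

/-- The Fermi function is smooth. [folklore] -/
theorem contDiff_fermiFunction {n : WithTop ℕ∞} : ContDiff ℝ n (fun E : ℝ => fermiFunction β E) := by
  unfold fermiFunction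
  simp_rw [one_div]
  refine ContDiff.inv (contDiff_const.add (Real.contDiff_exp.comp (contDiff_const.mul contDiff_id)))
    fun E => ?_
  positivity

/-- The Fermi function is continuous. [folklore] -/
theorem continuous_fermiFunction : Continuous (fun E : ℝ => fermiFunction β E) :=
  (contDiff_fermiFunction β (n := 0)).continuous

/-- `0 ≤ f_β(E) ≤ 1`. [folklore] -/
theorem fermiFunction_mem_Icc (E : ℝ) : fermiFunction β E ∈ Set.Icc (0 : ℝ) 1 := by
  unfold fermiFunction
  have h : 0 < 1 + Real.exp (β * E) := by positivity
  refine ⟨by positivity, ?_⟩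
  rw [div_le_one h]
  linarith [Real.exp_pos (β * E)]

/-- The symbol is continuous on `𝕋^d`. [folklore] -/
theorem continuous_hubbardFreeSymbol : Continuous (hubbardFreeSymbol (d := d) β μ) := by
  unfold hubbardFreeSymbol
  refine Complex.continuous_ofReal.comp ((continuous_fermiFunction β).comp ?_)
  refine ((continuous_const.mul (continuous_finsetSum _ fun i _ => ?_)).sub continuous_const)
  exact Complex.continuous_re.comp ((fourier 1).continuous.comp (continuous_apply i))

/-- **The free symbol is smooth on `𝕋^d`** (`Torus.IsSmooth` of `FlatTorus.lean`: its lift to `ℝ^d`,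
`y ↦ f_β(-2 Σᵢ cos 2πyᵢ - μ)`, is `C^∞`). At `β < ∞` the Fermi function smears the Fermi surface:
BGM 2006 §2.2 (the temperature as an infrared cutoff). [cite: BenfattoGiulianiMastropietro2006, §2.2] -/
theorem isSmooth_hubbardFreeSymbol : IsSmooth (hubbardFreeSymbol (d := d) β μ) := by
  have hlift : Literature.Analysis.FunctionSpaces.Torus.lift (hubbardFreeSymbol (d := d) β μ) =
      fun y : EuclideanSpace ℝ (Fin d) =>
        ((fermiFunction β (-2 * ∑ i, Real.cos (2 * Real.pi * y i) - μ) : ℝ) : ℂ) := by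
    funext y
    rw [Literature.Analysis.FunctionSpaces.Torus.lift_apply]
    exact hubbardFreeSymbol_coe β μ (fun i => y i)
  unfold IsSmooth
  rw [hlift]
  refine Complex.ofRealCLM.contDiff.comp ((contDiff_fermiFunction β).comp ?_)
  refine ContDiff.sub (contDiff_const.mul (ContDiff.sum fun i _ => ?_)) contDiff_const
  exact Real.contDiff_cos.comp (contDiff_const.mul (contDiff_piLp_apply 2))

/-- The symbol as a continuous map (the form Mathlib's Fourier inversion consumes). [folklore] -/
def hubbardFreeSymbolCM : C(UnitAddTorus (Fin d), ℂ) := ⟨hubbardFreeSymbol β μ, continuous_hubbardFreeSymbol β μ⟩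

/-- Coercion of `hubbardFreeSymbolCM`. [folklore] -/
@[simp] theorem coe_hubbardFreeSymbolCM : ⇑(hubbardFreeSymbolCM (d := d) β μ) = hubbardFreeSymbol β μ := rfl

/-- The Fourier coefficients of the free symbol are absolutely summable (smoothness,
`ScalarFourier.summable_norm_mFourierCoeff`). [folklore] -/
theorem summable_norm_mFourierCoeff_hubbardFreeSymbol :
    Summable fun n : Fin d → ℤ => ‖mFourierCoeff (hubbardFreeSymbol (d := d) β μ) n‖ :=
  Literature.Analysis.FluidPDE.ScalarFourier.summable_norm_mFourierCoeff (isSmooth_hubbardFreeSymbol β μ)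

end Symbol

/-! ### The infinite-volume free propagator and its decay -/

section Infinite

variable (β μ : ℝ)

/-- **The infinite-volume equal-time free propagator** of the Hubbard model (hopping `1`) at
inverse temperature `β` and chemical potential `μ`:
`S_∞(z) = ∫_{𝕋^d} e^{2πi t·z} f_β(-2Σᵢcos 2πtᵢ - μ) dt = (2π)^{-d} ∫_{[0,2π]^d} e^{ip·z} f_β(ε(p) - μ) dp`,
`z = y - x ∈ ℤ^d` — BGM's free propagator (2.4) at equal times "in the limit `L → ∞`", written as
the multiple Fourier coefficient `𝓕(hubbardFreeSymbol β μ)(-z)` (Haar probability measure on `𝕋^d`).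
[cite: BenfattoGiulianiMastropietro2006, eq. (2.4)] -/
def freePropagatorInfinite (z : Site d) : ℂ :=
  mFourierCoeff (hubbardFreeSymbol (d := d) β μ) (-z)

/-- Unfolding. [folklore] -/
theorem freePropagatorInfinite_apply (z : Site d) :
    freePropagatorInfinite β μ z = mFourierCoeff (hubbardFreeSymbol (d := d) β μ) (-z) := rfl

/-- **Summable decay of the infinite-volume free propagator**: `Σ_{z ∈ ℤ^d} |S_∞(z)| < ∞`
(smooth symbol at `β < ∞`). [cite: BenfattoGiulianiMastropietro2006, §2.2] -/
theorem summable_norm_freePropagatorInfinite :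
    Summable fun z : Site d => ‖freePropagatorInfinite (d := d) β μ z‖ :=
  ((summable_norm_mFourierCoeff_hubbardFreeSymbol β μ).comp_injective neg_injective :)

/-- **Polynomial decay of every order**: for every `K` there is `C ≥ 0` with
`|S_∞(z)| ≤ C (1 + ‖z‖)^{-K}` for all `z ∈ ℤ^d` (sup norm on `ℤ^d`; Grafakos 2014 §3.3.1 for the
coefficients of a smooth function; at fixed `β` this is the `N`-arbitrary decay BGM use scale by
scale, cf. (2.48)–(2.50)). [cite: BenfattoGiulianiMastropietro2006, §2.2] -/
theorem exists_decay_freePropagatorInfinite (K : ℕ) :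
    ∃ C : ℝ, 0 ≤ C ∧ ∀ z : Site d,
      ‖freePropagatorInfinite (d := d) β μ z‖ ≤ C * ((1 + ‖z‖) ^ K)⁻¹ := by
  obtain ⟨C, hC0, hC⟩ := Literature.Analysis.FluidPDE.ScalarFourier.exists_hasDecay_mFourierCoeff
    (isSmooth_hubbardFreeSymbol (d := d) β μ) K
  refine ⟨C, hC0, fun z => ?_⟩
  have := hC (-z)
  rwa [norm_neg] at this

end Infinite

/-! ### The torus propagator is the sum over images of the infinite-volume one -/

section Images

variable (β μ : ℝ)

/-- The momentum sum of `HubbardFreePropagator` as an inverse torus Fourier transform of the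
sampled symbol: `Σ_k F_{β,μ,z}(p_k) = Σ_k hubbardFreeSymbol(k/L) χ_k(z̄)`. [folklore] -/
theorem sum_freePropagatorIntegrand_latticeMomentum {L : ℕ} [NeZero L] (z : Site d) :
    ∑ k : TorusSite d L, freePropagatorIntegrand β μ z (latticeMomentum L k) =
      ∑ k : TorusSite d L, hubbardFreeSymbol β μ (torusPoint L k) * torusChar k (Torus.proj L z) := by
  refine Finset.sum_congr rfl fun k _ => ?_
  rw [freePropagatorIntegrand, torusChar_proj, hubbardFreeSymbol_torusPoint, mul_comm]

/-- **The free torus propagator is the periodization of the infinite-volume one** (BGM 2006 (1.4)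
at finite `L` versus (2.4); Glimm–Jaffe 1987 Prop. 7.3.1 on the lattice): for `L ≥ 3`,
`⟨c†_{xσ} c_{yσ'}⟩_{β,L,U=0} = δ_{σσ'} Σ_{n ∈ ℤ²} S_∞(y - x + Ln)`.
[cite: BenfattoGiulianiMastropietro2006, eq. (1.4)] -/
theorem hubbardThermalTwoPoint_zero_interaction_eq_tsum_images {L : ℕ} (hL : 3 ≤ L) (x y : Site 2)
    (σ σ' : Fin 2) :
    hubbardThermalTwoPoint β 0 μ L x y σ σ' =
      if σ = σ' then ∑' n : Site 2, freePropagatorInfinite β μ (y - x + (L : ℤ) • n) else 0 := by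
  haveI : NeZero L := ⟨by omega⟩
  unfold hubbardThermalTwoPoint
  rw [dif_neg (NeZero.ne L), thermalCorr_hubbardTorusWith_zero_interaction_eq_sum_latticeMomentum hL]
  split_ifs with h
  · rw [sum_freePropagatorIntegrand_latticeMomentum, ← torusFourierInv_eq_sum_torusChar]
    have := torusFourierInv_apply_torusPoint_eq_tsum (L := L) (hubbardFreeSymbolCM β μ)
      (summable_norm_mFourierCoeff_hubbardFreeSymbol β μ) (y - x)
    simp only [coe_hubbardFreeSymbolCM] at this
    rw [this]
    rfl
  · rfl

/-- **Finite-size correction of the free propagator**: for `L ≥ 3` and every box radius `R` with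
`R + 1 + Σᵢ|(y - x)ᵢ| ≤ L`,
`|⟨c†_{xσ} c_{yσ}⟩_{β,L,U=0} - S_∞(y - x)| ≤ Σ_{w ∉ {-R,…,R}²} |S_∞(w)|` — the sum over the non-zero
images, a tail of the convergent series `Σ_w |S_∞(w)|`; with `exists_decay_freePropagatorInfinite`
this is `O_K((1 + R)^{2-K})` for every `K` (BGM 2006 §2.2 footnote 1: estimates uniform in `L`).
[cite: BenfattoGiulianiMastropietro2006, §2.2] -/
theorem norm_hubbardThermalTwoPoint_zero_interaction_sub_le {L R : ℕ} (hL : 3 ≤ L) (x y : Site 2)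
    (σ : Fin 2) (hR : (R : ℤ) + 1 + ∑ i, |(y - x) i| ≤ L) :
    ‖hubbardThermalTwoPoint β 0 μ L x y σ σ - freePropagatorInfinite β μ (y - x)‖ ≤
      ∑' w : {w // w ∉ box 2 R}, ‖freePropagatorInfinite β μ (w : Site 2)‖ := by
  rw [hubbardThermalTwoPoint_zero_interaction_eq_tsum_images β μ hL, if_pos rfl]
  exact norm_tsum_translate_sub_le (summable_norm_freePropagatorInfinite β μ) (by omega) (y - x) hR

/-- **The thermodynamic limit of the free propagator, by periodization**: as `L → ∞`,
`⟨c†_{xσ} c_{yσ'}⟩_{β,L,U=0} → δ_{σσ'} S_∞(y - x)` (a second proof of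
`tendsto_hubbardThermalTwoPoint_zero_interaction`, now with the infinite-volume propagator in
Fourier-coefficient form and the rate of `norm_hubbardThermalTwoPoint_zero_interaction_sub_le`).
[cite: BenfattoGiulianiMastropietro2006, eq. (2.4)] -/
theorem tendsto_hubbardThermalTwoPoint_zero_interaction' (x y : Site 2) (σ σ' : Fin 2) :
    Tendsto (fun L : ℕ => hubbardThermalTwoPoint β 0 μ L x y σ σ') atTop
      (𝓝 (if σ = σ' then freePropagatorInfinite β μ (y - x) else 0)) := by
  have hev : (fun L : ℕ => hubbardThermalTwoPoint β 0 μ L x y σ σ') =ᶠ[atTop]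
      fun L => if σ = σ' then ∑' n : Site 2, freePropagatorInfinite β μ (y - x + (L : ℤ) • n) else 0 :=
    (eventually_ge_atTop 3).mono fun L hL =>
      hubbardThermalTwoPoint_zero_interaction_eq_tsum_images β μ hL x y σ σ'
  rw [tendsto_congr' hev]
  split_ifs
  · exact tendsto_tsum_translate (summable_norm_freePropagatorInfinite β μ) (y - x)
  · exact tendsto_const_nhds

/-- **Identification with the Brillouin-zone integral** of `HubbardFreePropagatorLimit.lean`
(uniqueness of the limit of the torus propagators): for every `z ∈ ℤ²`,
`S_∞(z) = (2π)⁻² ∫_{[-π,π)²} F_{β,μ,z}(q + π) dq`, `F_{β,μ,z}(p) = e^{ip·z} f_β(-2Σcos pᵢ - μ)`.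
[cite: BenfattoGiulianiMastropietro2006, eq. (2.4)] -/
theorem freePropagatorInfinite_eq_integral_brillouin (z : Site 2) :
    freePropagatorInfinite β μ z =
      (((2 * Real.pi) ^ 2 : ℝ) : ℂ)⁻¹ *
        ∫ q in brillouin 2, freePropagatorIntegrand β μ z (q + fun _ => Real.pi) := by
  have h1 := tendsto_hubbardThermalTwoPoint_zero_interaction' β μ 0 z 0 0
  have h2 := tendsto_hubbardThermalTwoPoint_zero_interaction β μ 0 z 0 0
  simp only [if_true, sub_zero] at h1 h2
  exact tendsto_nhds_unique h1 h2

end Images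

end Literature.MathematicalPhysics.QuantumLattice

end
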